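import Literature.Probability.LatticeModels.KilledWalkLaplacian
import HarnessLib

/-!
# The Green function of the edge-killed walk in a finite region of `ℤ²`

Topic `Literature/Probability/LatticeModels`; continuation of `KilledWalkLaplacian.lean` (the
simple random walk on `ℤ²` run along the edges of a subgraph `Gr` and killed at its first step
that is not a `Gr`-edge; neighbour average `killedAvg Gr`). For a finite region `S ⊆ ℤ²` we
construct the **Green function** `killedRegionGreen Gr S v u` of the walk in `S` — the expected
number of visits to `u` before the walk leaves `S` or is killed, started at `v` — analytically, as
the solution of `killedAvg Gr g - g = -𝟙_{u}` on `S` vanishing off `S` (Chelkak 2016, §2.3: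
"the unique function which is discrete harmonic everywhere in `Ω` except at `u`, vanishes on the
boundary, and `[ΔG](u) = -μ_u⁻¹`"; Lawler–Limic 2010, §4.6 and §6.2). Everything is proved and
no random walk is used:

* `exists_killedGreen_column`, `killedRegionGreen` and its defining identities
  (`killedAvg_killedRegionGreen_sub`), vanishing off the region, nonnegativity, `G(u,u) ≥ 1`;
* **symmetry** `killedRegionGreen_comm` (Green's second identity `sum_mul_killedAvg_comm` for
  functions vanishing off `S`: the killed average is a symmetric operator);
* **Green's representation formula** `eq_sum_killedRegionGreen_add_killedHarmExt`:
  `F v = ∑_{y ∈ S} G_S(v,y) (F y - killedAvg Gr F y) + killedHarmExt Gr S F v` on `S`, and the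
  **last-exit formula** for the Poisson kernel `killedPoisson_eq_sum_killedRegionGreen`;
* **monotonicity** in the region (`killedRegionGreen_mono_set`) and in the graph
  (`killedRegionGreen_mono_graph`: more edges, fewer killings, larger Green function);
* the **exit-time function** `killedExitTime Gr S v = ∑_{y ∈ S} G_S(v,y)` (`= E_v[τ]`), its
  equation `killedAvg T - T = -1`, and the quadratic comparison bounds for the free walk
  (`killedAvg_normSqFrom` : the free average of `|· - c|²` is `|· - c|² + 1`):
  `killedExitTime ≤ R²` on a region inside the ball of radius `R` (`killedExitTime_le_of_subset`)
  and, for the walk with all edges of a ball of radius `r` about `u` available,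
  `r² - |v - u|² - … ≤ killedExitTime` (`sub_normSqFrom_le_killedExitTime`) — Chelkak's
  property (T) ("time spent in a disc is of order `r²`") for the square lattice.

## References

* D. Chelkak, *Robust discrete complex analysis: a toolbox*, Ann. Probab. 44 (2016), §2.3
  (Green's function, partition functions), §2.4 (property (T)). [Chelkak2016]
* G. F. Lawler, V. Limic, *Random Walk: A Modern Introduction*, CUP (2010), §4.6, §6.2
  (Green's function of a finite set, last-exit decomposition `H_A(x,y) = ∑ G_A(x,z) p(z,y)`).
  [LawlerLimic2010]
-/

noncomputable section

open scoped Classical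

namespace Literature.Probability.LatticeModels

open Finset

variable (Gr : SimpleGraph (Site 2))

/-! ### Finite sums and the killed average -/

/-- The killed average commutes with finite sums. [folklore] -/
theorem killedAvg_finset_sum {ι : Type*} (s : Finset ι) (f : ι → Site 2 → ℝ) (v : Site 2) :
    killedAvg Gr (fun w => ∑ i ∈ s, f i w) v = ∑ i ∈ s, killedAvg Gr (f i) v := by
  induction s using Finset.induction_on with
  | empty => simp
  | insert a s ha ih =>
    simp only [Finset.sum_insert ha]
    rw [← ih, ← killedAvg_add]
    rfl

/-- The killed average of `w ↦ c * f w` (pointwise product with a constant). [folklore] -/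
theorem killedAvg_mul_left (c : ℝ) (f : Site 2 → ℝ) (v : Site 2) :
    killedAvg Gr (fun w => c * f w) v = c * killedAvg Gr f v :=
  killedAvg_const_mul Gr c f v

/-- **Monotonicity of the killed average in the graph**: for a nonnegative function, adding edges
can only increase the average. [folklore] -/
theorem killedAvg_mono_graph {Gr Gr' : SimpleGraph (Site 2)} (hle : Gr ≤ Gr') {f : Site 2 → ℝ}
    (hf : ∀ w, 0 ≤ f w) (v : Site 2) : killedAvg Gr f v ≤ killedAvg Gr' f v := by
  simp only [killedAvg]
  refine mul_le_mul_of_nonneg_left (Finset.sum_le_sum fun e _ => ?_) (by norm_num)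
  by_cases h : Gr.Adj v (v + SRW.stepVec e)
  · rw [if_pos h, if_pos (hle h)]
  · rw [if_neg h]
    split_ifs
    · exact hf _
    · exact le_rfl

/-! ### Green's second identity for the killed average -/

/-- **The killed average is a symmetric operator on functions vanishing off a finite set**:
`∑_{v ∈ S} f v · killedAvg Gr g v = ∑_{v ∈ S} g v · killedAvg Gr f v` whenever `f = g = 0` off
`S` (reindex the sum over ordered `Gr`-edges inside `S` by reversing the edge). [folklore] -/
theorem sum_mul_killedAvg_comm {S : Finset (Site 2)} {f g : Site 2 → ℝ}
    (hf : ∀ w ∉ S, f w = 0) (hg : ∀ w ∉ S, g w = 0) :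
    ∑ v ∈ S, f v * killedAvg Gr g v = ∑ v ∈ S, g v * killedAvg Gr f v := by
  -- both sides as sums over the pairs `(v, e)` with `v ∈ S` and `v + e ∈ S`
  set P : Finset (Site 2 × SRW.Dir 2) := (S ×ˢ Finset.univ).filter
    (fun p => p.1 + SRW.stepVec p.2 ∈ S) with hP
  have expand : ∀ (f g : Site 2 → ℝ), (∀ w ∉ S, g w = 0) →
      ∑ v ∈ S, f v * killedAvg Gr g v = 4⁻¹ * ∑ p ∈ P,
        (if Gr.Adj p.1 (p.1 + SRW.stepVec p.2) then f p.1 * g (p.1 + SRW.stepVec p.2) else 0) := by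
    intro f g hg
    have h1 : ∀ v ∈ S, f v * killedAvg Gr g v = 4⁻¹ * ∑ e : SRW.Dir 2,
        (if Gr.Adj v (v + SRW.stepVec e) then f v * g (v + SRW.stepVec e) else 0) := by
      intro v _
      rw [killedAvg, Finset.mul_sum, Finset.mul_sum, Finset.mul_sum]
      refine Finset.sum_congr rfl fun e _ => ?_
      split_ifs <;> ring
    rw [Finset.sum_congr rfl h1, ← Finset.mul_sum, hP, Finset.sum_filter, Finset.sum_product]
    congr 1
    refine Finset.sum_congr rfl fun v _ => Finset.sum_congr rfl fun e _ => ?_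
    by_cases hmem : v + SRW.stepVec e ∈ S
    · rw [if_pos hmem]
    · rw [if_neg hmem]
      split_ifs
      · rw [hg _ hmem, mul_zero]
      · rfl
  rw [expand f g hg, expand g f hf]
  congr 1
  -- the edge-reversing involution
  refine Finset.sum_nbij' (fun p => (p.1 + SRW.stepVec p.2, p.2.neg))
    (fun p => (p.1 + SRW.stepVec p.2, p.2.neg)) ?_ ?_ ?_ ?_ ?_
  · intro p hp
    simp only [hP, Finset.mem_filter, Finset.mem_product, Finset.mem_univ, and_true] at hp ⊢
    refine ⟨hp.2, ?_⟩
    rw [SRW.stepVec_neg, add_neg_cancel_right]; exact hp.1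
  · intro p hp
    simp only [hP, Finset.mem_filter, Finset.mem_product, Finset.mem_univ, and_true] at hp ⊢
    refine ⟨hp.2, ?_⟩
    rw [SRW.stepVec_neg, add_neg_cancel_right]; exact hp.1
  · intro p _
    ext <;> simp [SRW.stepVec_neg]
  · intro p _
    ext <;> simp [SRW.stepVec_neg]
  · intro p _
    simp only [SRW.stepVec_neg, add_neg_cancel_right]
    by_cases h : Gr.Adj p.1 (p.1 + SRW.stepVec p.2)
    · rw [if_pos h, if_pos h.symm, mul_comm]
    · rw [if_neg h, if_neg fun h' => h h'.symm]

/-! ### The Green function of a finite region -/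

variable {Gr}

/-- **Existence of the Green column**: for finite `S ∋ u` there is `g` vanishing off `S` with
`killedAvg Gr g - g = -𝟙_{u}` on `S` (the Dirichlet operator of `S` is onto). [cite: Chelkak2016, §2.3] -/
theorem exists_killedGreen_column {S : Set (Site 2)} (hS : S.Finite) (u : Site 2) :
    ∃ g : Site 2 → ℝ, (∀ w ∉ S, g w = 0) ∧
      ∀ v ∈ S, killedAvg Gr g v - g v = -(if v = u then 1 else 0) := by
  haveI : Fintype S := hS.fintype
  have hsurj : Function.Surjective (killedDirichletOperator Gr S) :=
    LinearMap.injective_iff_surjective.1 (killedDirichletOperator_injective hS)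
  obtain ⟨w, hw⟩ := hsurj fun v => -(if (v : Site 2) = u then 1 else 0)
  refine ⟨extendByZero S w, fun x hx => extendByZero_of_not_mem w hx, fun v hv => ?_⟩
  have h1 := congrArg (fun f : S → ℝ => f ⟨v, hv⟩) hw
  simpa [killedDirichletOperator] using h1

variable (Gr)

/-- **The Green function of the edge-killed walk in the region `S`**: for finite `S` and `u ∈ S`,
`v ↦ killedRegionGreen Gr S v u` is the function vanishing off `S` with
`killedAvg Gr G(·,u) - G(·,u) = -𝟙_{u}` on `S` — the expected number of visits to `u` of the walk
started at `v`, run along `Gr` and killed at its first non-`Gr` step, before it leaves `S`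
(Chelkak 2016, §2.3, `G_Ω(v;u)`; Lawler–Limic 2010, §4.6). Junk value `0` if `S` is infinite or
`u ∉ S`. [cite: Chelkak2016, §2.3] -/
def killedRegionGreen (S : Set (Site 2)) (v u : Site 2) : ℝ :=
  if h : S.Finite ∧ u ∈ S then (exists_killedGreen_column (Gr := Gr) h.1 u).choose v else 0

variable {Gr}

/-- The Green function vanishes when the pole is outside the region. [folklore] -/
theorem killedRegionGreen_of_not_mem_right (S : Set (Site 2)) (v : Site 2) {u : Site 2} (hu : u ∉ S) :
    killedRegionGreen Gr S v u = 0 := by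
  simp [killedRegionGreen, hu]

/-- The Green function of an infinite set is the junk value `0`. [folklore] -/
theorem killedRegionGreen_of_infinite {S : Set (Site 2)} (hS : ¬ S.Finite) (v u : Site 2) :
    killedRegionGreen Gr S v u = 0 := by
  simp [killedRegionGreen, hS]

/-- The Green function vanishes when the first argument is outside the region. [folklore] -/
theorem killedRegionGreen_of_not_mem_left (S : Set (Site 2)) {v : Site 2} (hv : v ∉ S) (u : Site 2) :
    killedRegionGreen Gr S v u = 0 := by
  unfold killedRegionGreen
  split_ifs with h
  · exact (exists_killedGreen_column (Gr := Gr) h.1 u).choose_spec.1 v hv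
  · rfl

/-- **The defining identity**: for finite `S` and `u ∈ S`, on `S`,
`killedAvg Gr G(·,u) v - G(v,u) = -𝟙_{v = u}`. [cite: Chelkak2016, §2.3] -/
theorem killedAvg_killedRegionGreen_sub {S : Set (Site 2)} (hS : S.Finite) {u : Site 2} (hu : u ∈ S) :
    ∀ v ∈ S, killedAvg Gr (fun w => killedRegionGreen Gr S w u) v - killedRegionGreen Gr S v u =
      -(if v = u then 1 else 0) := by
  intro v hv
  have key := (exists_killedGreen_column (Gr := Gr) hS u).choose_spec.2 v hv
  have hfun : (fun w => killedRegionGreen Gr S w u) = (exists_killedGreen_column (Gr := Gr) hS u).choose := by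
    funext w; simp [killedRegionGreen, hS, hu]
  rw [hfun]
  convert key using 2
  simp [killedRegionGreen, hS, hu]

/-- The Green function is killed-harmonic in its first variable off the pole. [folklore] -/
theorem killedRegionGreen_harmonicOn {S : Set (Site 2)} (hS : S.Finite) (u : Site 2) :
    IsKilledHarmonicOn Gr (fun w => killedRegionGreen Gr S w u) (S \ {u}) := by
  intro v hv
  by_cases hu : u ∈ S
  · have := killedAvg_killedRegionGreen_sub (Gr := Gr) hS hu v hv.1
    have hvu : v ≠ u := fun h => hv.2 (by rw [h]; rfl)
    rw [if_neg hvu] at this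
    simp only [neg_zero, sub_eq_zero] at this
    exact this.symm
  · simp only [killedRegionGreen_of_not_mem_right S _ hu]
    exact (killedAvg_zero Gr v).symm

/-- At the pole: `G(u,u) = 1 + killedAvg Gr G(·,u) u`. [folklore] -/
theorem killedRegionGreen_diag {S : Set (Site 2)} (hS : S.Finite) {u : Site 2} (hu : u ∈ S) :
    killedRegionGreen Gr S u u = 1 + killedAvg Gr (fun w => killedRegionGreen Gr S w u) u := by
  have := killedAvg_killedRegionGreen_sub (Gr := Gr) hS hu u hu
  rw [if_pos rfl] at this
  linarith

/-- The Green function is killed-superharmonic in its first variable on the whole region. [folklore] -/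
theorem killedRegionGreen_superharmonicOn {S : Set (Site 2)} (hS : S.Finite) (u : Site 2) :
    IsKilledSuperharmonicOn Gr (fun w => killedRegionGreen Gr S w u) S := by
  intro v hv
  by_cases hu : u ∈ S
  · have := killedAvg_killedRegionGreen_sub (Gr := Gr) hS hu v hv
    split_ifs at this <;> linarith
  · simp only [killedRegionGreen_of_not_mem_right S _ hu, killedAvg_zero]
    exact le_rfl

/-- **The Green function is nonnegative** (minimum principle). [folklore] -/
theorem killedRegionGreen_nonneg (S : Set (Site 2)) (v u : Site 2) : 0 ≤ killedRegionGreen Gr S v u := by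
  by_cases hS : S.Finite
  · by_cases hv : v ∈ S
    · exact (killedRegionGreen_superharmonicOn hS u).ge_of_forall_boundary_ge hS le_rfl
        (fun w hw => (killedRegionGreen_of_not_mem_left S hw.1 u).ge) v hv
    · exact (killedRegionGreen_of_not_mem_left S hv u).ge
  · exact (killedRegionGreen_of_infinite hS v u).ge

/-- **At least one visit at the pole**: `1 ≤ G(u,u)` for `u` in the finite region. [folklore] -/
theorem one_le_killedRegionGreen_diag {S : Set (Site 2)} (hS : S.Finite) {u : Site 2} (hu : u ∈ S) :
    1 ≤ killedRegionGreen Gr S u u := by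
  rw [killedRegionGreen_diag hS hu]
  have : 0 ≤ killedAvg Gr (fun w => killedRegionGreen Gr S w u) u :=
    killedAvg_nonneg Gr fun e _ => killedRegionGreen_nonneg S _ u
  linarith

/-- **Symmetry of the Green function**: `G_S(v,u) = G_S(u,v)` (Green's second identity;
Chelkak 2016, §2.3: "`G_Ω` is symmetric"; probabilistically, path reversal). [cite: Chelkak2016, §2.3] -/
theorem killedRegionGreen_comm (S : Set (Site 2)) (v u : Site 2) :
    killedRegionGreen Gr S v u = killedRegionGreen Gr S u v := by
  by_cases hS : S.Finite
  swap
  · rw [killedRegionGreen_of_infinite hS, killedRegionGreen_of_infinite hS]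
  by_cases hu : u ∈ S
  swap
  · rw [killedRegionGreen_of_not_mem_right S v hu, killedRegionGreen_of_not_mem_left S hu v]
  by_cases hv : v ∈ S
  swap
  · rw [killedRegionGreen_of_not_mem_left S hv u, killedRegionGreen_of_not_mem_right S u hv]
  set f : Site 2 → ℝ := fun w => killedRegionGreen Gr S w u with hf
  set g : Site 2 → ℝ := fun w => killedRegionGreen Gr S w v with hg
  have hf0 : ∀ w ∉ hS.toFinset, f w = 0 := fun w hw =>
    killedRegionGreen_of_not_mem_left S (by rwa [Set.Finite.mem_toFinset] at hw) u
  have hg0 : ∀ w ∉ hS.toFinset, g w = 0 := fun w hw =>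
    killedRegionGreen_of_not_mem_left S (by rwa [Set.Finite.mem_toFinset] at hw) v
  have key := sum_mul_killedAvg_comm Gr hf0 hg0
  -- subtract `∑ f g` from both sides and use the defining identities
  have h1 : ∑ w ∈ hS.toFinset, f w * (killedAvg Gr g w - g w) =
      ∑ w ∈ hS.toFinset, g w * (killedAvg Gr f w - f w) := by
    simp only [mul_sub, Finset.sum_sub_distrib, key, mul_comm (f _) (g _)]
  have h2 : ∑ w ∈ hS.toFinset, f w * (killedAvg Gr g w - g w) = -f v := by
    rw [Finset.sum_eq_single_of_mem v (hS.mem_toFinset.2 hv)]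
    · rw [hg, killedAvg_killedRegionGreen_sub hS hv v hv, if_pos rfl]; ring
    · intro w hw hwv
      rw [hg, killedAvg_killedRegionGreen_sub hS hv w (hS.mem_toFinset.1 hw), if_neg hwv]; ring
  have h3 : ∑ w ∈ hS.toFinset, g w * (killedAvg Gr f w - f w) = -g u := by
    rw [Finset.sum_eq_single_of_mem u (hS.mem_toFinset.2 hu)]
    · rw [hf, killedAvg_killedRegionGreen_sub hS hu u hu, if_pos rfl]; ring
    · intro w hw hwu
      rw [hf, killedAvg_killedRegionGreen_sub hS hu w (hS.mem_toFinset.1 hw), if_neg hwu]; ring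
  have : f v = g u := by linarith [h1.symm.trans h2 ▸ h3]
  simpa [hf, hg] using this


/-! ### Green's representation formula and the last-exit formula -/

/-- **Green's representation formula.** For finite `S` and any `F : ℤ² → ℝ`, on `S`,
`F v = ∑_{y ∈ S} G_S(v,y) · (F y - killedAvg Gr F y) + killedHarmExt Gr S F v`: the Green
potential of `-(Δ_kill F)` plus the harmonic extension of the boundary values (Lawler–Limic 2010,
Prop. 6.2.?; Chelkak 2016, §2.3). [cite: LawlerLimic2010, §6.2] -/
theorem eq_sum_killedRegionGreen_add_killedHarmExt {S : Set (Site 2)} (hS : S.Finite) (F : Site 2 → ℝ) :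
    ∀ v ∈ S, F v = ∑ y ∈ hS.toFinset, killedRegionGreen Gr S v y * (F y - killedAvg Gr F y) +
      killedHarmExt Gr S F v := by
  set ψ : Site 2 → ℝ := fun y => F y - killedAvg Gr F y with hψ
  set Φ : Site 2 → ℝ := fun v => ∑ y ∈ hS.toFinset, killedRegionGreen Gr S v y * ψ y with hΦ
  -- `Φ` solves the Poisson problem with source `ψ`
  have hΦS : ∀ v ∈ S, killedAvg Gr Φ v - Φ v = -ψ v := by
    intro v hv
    have h1 : killedAvg Gr Φ v = ∑ y ∈ hS.toFinset, ψ y * killedAvg Gr (fun w => killedRegionGreen Gr S w y) v := by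
      rw [hΦ, killedAvg_finset_sum]
      refine Finset.sum_congr rfl fun y _ => ?_
      rw [← killedAvg_mul_left]
      congr 1; funext w; ring
    have h2 : Φ v = ∑ y ∈ hS.toFinset, ψ y * killedRegionGreen Gr S v y := by
      rw [hΦ]; exact Finset.sum_congr rfl fun y _ => mul_comm _ _
    rw [h1, h2, ← Finset.sum_sub_distrib]
    have h3 : ∀ y ∈ hS.toFinset, ψ y * killedAvg Gr (fun w => killedRegionGreen Gr S w y) v -
        ψ y * killedRegionGreen Gr S v y = ψ y * -(if v = y then 1 else 0) := by
      intro y hy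
      rw [← mul_sub, killedAvg_killedRegionGreen_sub hS (hS.mem_toFinset.1 hy) v hv]
    rw [Finset.sum_congr rfl h3, Finset.sum_eq_single_of_mem v (hS.mem_toFinset.2 hv)]
    · simp
    · intro y _ hyv; rw [if_neg (Ne.symm hyv)]; ring
  have hΦ0 : ∀ w ∉ S, Φ w = 0 := fun w hw => by
    rw [hΦ]; exact Finset.sum_eq_zero fun y _ => by rw [killedRegionGreen_of_not_mem_left S hw, zero_mul]
  -- `F - Φ` is killed-harmonic on `S` with boundary values `F`
  have hharm : IsKilledHarmonicOn Gr (F - Φ) S := fun v hv => by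
    rw [killedAvg_sub, Pi.sub_apply]
    have := hΦS v hv
    rw [hψ] at this
    simp only at this
    linarith
  intro v hv
  have key := hharm.eq_killedHarmExt hS (g := F) (fun w hw => by rw [Pi.sub_apply, hΦ0 w hw.1, sub_zero]) v hv
  rw [Pi.sub_apply] at key
  linarith

/-- **The Green potential**: for finite `S` and a source `ψ`, the function
`v ↦ ∑_{y ∈ S} G_S(v,y) ψ y` vanishes off `S` and solves `killedAvg Φ - Φ = -ψ` on `S`. [folklore] -/
theorem killedAvg_sum_killedRegionGreen_mul {S : Set (Site 2)} (hS : S.Finite) (ψ : Site 2 → ℝ) :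
    ∀ v ∈ S, killedAvg Gr (fun w => ∑ y ∈ hS.toFinset, killedRegionGreen Gr S w y * ψ y) v -
      ∑ y ∈ hS.toFinset, killedRegionGreen Gr S v y * ψ y = -ψ v := by
  intro v hv
  rw [killedAvg_finset_sum]
  have h1 : ∀ y ∈ hS.toFinset, killedAvg Gr (fun w => killedRegionGreen Gr S w y * ψ y) v =
      ψ y * killedAvg Gr (fun w => killedRegionGreen Gr S w y) v := by
    intro y _
    rw [← killedAvg_mul_left]; congr 1; funext w; ring
  rw [Finset.sum_congr rfl h1, Finset.sum_congr rfl (fun y _ => mul_comm (killedRegionGreen Gr S v y) (ψ y)),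
    ← Finset.sum_sub_distrib]
  have h3 : ∀ y ∈ hS.toFinset, ψ y * killedAvg Gr (fun w => killedRegionGreen Gr S w y) v -
      ψ y * killedRegionGreen Gr S v y = ψ y * -(if v = y then 1 else 0) := by
    intro y hy
    rw [← mul_sub, killedAvg_killedRegionGreen_sub hS (hS.mem_toFinset.1 hy) v hv]
  rw [Finset.sum_congr rfl h3, Finset.sum_eq_single_of_mem v (hS.mem_toFinset.2 hv)]
  · simp
  · intro y _ hyv; rw [if_neg (Ne.symm hyv)]; ring

/-- **Last-exit formula for the Poisson kernel**: for `x ∉ S`,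
`killedPoisson Gr S v x = ∑_{y ∈ S} G_S(v,y) · killedAvg Gr 𝟙_{x} y`, i.e. `¼ ∑` over the
`Gr`-edges `y → x` from `S` of `G_S(v,y)` (Lawler–Limic 2010, Lemma 6.3.6-type last-exit
decomposition `H_A(x,y) = ∑_z G_A(x,z) p(z,y)`). [cite: LawlerLimic2010, §6.2] -/
theorem killedPoisson_eq_sum_killedRegionGreen {S : Set (Site 2)} (hS : S.Finite) {x : Site 2} (hx : x ∉ S) :
    ∀ v ∈ S, killedPoisson Gr S v x =
      ∑ y ∈ hS.toFinset, killedRegionGreen Gr S v y * killedAvg Gr (fun w => if w = x then 1 else 0) y := by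
  intro v hv
  have key := eq_sum_killedRegionGreen_add_killedHarmExt (Gr := Gr) hS (fun w => if w = x then (1:ℝ) else 0) v hv
  have hvx : v ≠ x := fun h => hx (h ▸ hv)
  rw [if_neg hvx] at key
  have h1 : ∀ y ∈ hS.toFinset, killedRegionGreen Gr S v y *
      ((if y = x then (1:ℝ) else 0) - killedAvg Gr (fun w => if w = x then 1 else 0) y) =
      -(killedRegionGreen Gr S v y * killedAvg Gr (fun w => if w = x then 1 else 0) y) := by
    intro y hy
    have hyx : y ≠ x := fun h => hx (h ▸ hS.mem_toFinset.1 hy)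
    rw [if_neg hyx]; ring
  rw [Finset.sum_congr rfl h1, Finset.sum_neg_distrib] at key
  rw [killedPoisson]
  linarith

/-! ### Monotonicity in the region and in the graph -/

/-- **Monotonicity in the region**: `S ⊆ S'` (finite) gives `G_S ≤ G_{S'}`. [cite: LawlerLimic2010, §4.6] -/
theorem killedRegionGreen_mono_set {S S' : Set (Site 2)} (hS' : S'.Finite) (hSS' : S ⊆ S') (v u : Site 2) :
    killedRegionGreen Gr S v u ≤ killedRegionGreen Gr S' v u := by
  have hS : S.Finite := hS'.subset hSS'
  by_cases hu : u ∈ S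
  swap
  · rw [killedRegionGreen_of_not_mem_right S v hu]; exact killedRegionGreen_nonneg S' v u
  by_cases hv : v ∈ S
  swap
  · rw [killedRegionGreen_of_not_mem_left S hv u]; exact killedRegionGreen_nonneg S' v u
  -- the difference is killed-harmonic on `S` with nonnegative boundary values
  have hD : IsKilledHarmonicOn Gr
      ((fun w => killedRegionGreen Gr S' w u) - fun w => killedRegionGreen Gr S w u) S := by
    intro w hw
    rw [killedAvg_sub, Pi.sub_apply]
    have h1 := killedAvg_killedRegionGreen_sub (Gr := Gr) hS' (hSS' hu) w (hSS' hw)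
    have h2 := killedAvg_killedRegionGreen_sub (Gr := Gr) hS hu w hw
    linarith
  have := hD.ge_of_forall_boundary_ge hS le_rfl (fun w hw => by
    rw [Pi.sub_apply, killedRegionGreen_of_not_mem_left S hw.1 u, sub_zero]
    exact killedRegionGreen_nonneg S' w u) v hv
  rw [Pi.sub_apply] at this
  linarith

/-- **Monotonicity in the graph**: `Gr ≤ Gr'` (more edges, fewer killings) gives
`G^{Gr}_S ≤ G^{Gr'}_S`. [folklore] -/
theorem killedRegionGreen_mono_graph {Gr Gr' : SimpleGraph (Site 2)} (hle : Gr ≤ Gr') (S : Set (Site 2))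
    (v u : Site 2) : killedRegionGreen Gr S v u ≤ killedRegionGreen Gr' S v u := by
  by_cases hS : S.Finite
  swap
  · rw [killedRegionGreen_of_infinite hS, killedRegionGreen_of_infinite hS]
  by_cases hu : u ∈ S
  swap
  · rw [killedRegionGreen_of_not_mem_right S v hu, killedRegionGreen_of_not_mem_right S v hu]
  by_cases hv : v ∈ S
  swap
  · rw [killedRegionGreen_of_not_mem_left S hv u, killedRegionGreen_of_not_mem_left S hv u]
  set g' : Site 2 → ℝ := fun w => killedRegionGreen Gr' S w u with hg'
  set g : Site 2 → ℝ := fun w => killedRegionGreen Gr S w u with hg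
  -- `g' - g` is `Gr`-superharmonic on `S` with zero boundary values
  have hsup : IsKilledSuperharmonicOn Gr (g' - g) S := by
    intro w hw
    rw [killedAvg_sub, Pi.sub_apply]
    have h1 : killedAvg Gr g' w ≤ killedAvg Gr' g' w :=
      killedAvg_mono_graph hle (fun x => killedRegionGreen_nonneg S x u) w
    have h2 := killedAvg_killedRegionGreen_sub (Gr := Gr') hS hu w hw
    have h3 := killedAvg_killedRegionGreen_sub (Gr := Gr) hS hu w hw
    simp only [← hg', ← hg] at h2 h3
    linarith
  have := hsup.ge_of_forall_boundary_ge hS le_rfl (fun w hw => by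
    rw [Pi.sub_apply, hg, hg']
    simp only [killedRegionGreen_of_not_mem_left S hw.1 u, sub_zero]; exact le_rfl) v hv
  rw [Pi.sub_apply] at this
  simp only [hg, hg'] at this
  linarith

/-! ### The exit-time function and the quadratic comparison (property (T)) -/

variable (Gr)

/-- **The exit-time function** `T_S(v) = ∑_{y ∈ S} G_S(v,y)`: the expected number of steps the
walk started at `v` makes before leaving `S` or being killed (junk `0` for infinite `S`). [folklore] -/
def killedExitTime (S : Set (Site 2)) (v : Site 2) : ℝ :=
  if hS : S.Finite then ∑ y ∈ hS.toFinset, killedRegionGreen Gr S v y else 0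

variable {Gr}

/-- The exit-time function for a finite region, unfolded. [folklore] -/
theorem killedExitTime_eq {S : Set (Site 2)} (hS : S.Finite) (v : Site 2) :
    killedExitTime Gr S v = ∑ y ∈ hS.toFinset, killedRegionGreen Gr S v y := by
  simp [killedExitTime, hS]

/-- The exit-time function vanishes off the region. [folklore] -/
theorem killedExitTime_of_not_mem {S : Set (Site 2)} {v : Site 2} (hv : v ∉ S) : killedExitTime Gr S v = 0 := by
  by_cases hS : S.Finite
  · rw [killedExitTime_eq hS]
    exact Finset.sum_eq_zero fun y _ => killedRegionGreen_of_not_mem_left S hv y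
  · simp [killedExitTime, hS]

/-- The exit-time function is nonnegative. [folklore] -/
theorem killedExitTime_nonneg (S : Set (Site 2)) (v : Site 2) : 0 ≤ killedExitTime Gr S v := by
  by_cases hS : S.Finite
  · rw [killedExitTime_eq hS]; exact Finset.sum_nonneg fun y _ => killedRegionGreen_nonneg S v y
  · simp [killedExitTime, hS]

/-- **The exit-time equation**: `killedAvg Gr T_S v - T_S v = -1` on the finite region `S`. [folklore] -/
theorem killedAvg_killedExitTime_sub {S : Set (Site 2)} (hS : S.Finite) :
    ∀ v ∈ S, killedAvg Gr (killedExitTime Gr S) v - killedExitTime Gr S v = -1 := by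
  intro v hv
  have hfun : killedExitTime Gr S = fun w => ∑ y ∈ hS.toFinset, killedRegionGreen Gr S w y * (1 : ℝ) := by
    funext w; rw [killedExitTime_eq hS]; simp
  rw [hfun]
  simpa using killedAvg_sum_killedRegionGreen_mul hS (fun _ => (1 : ℝ)) v hv

/-- Monotonicity of the exit time in the region. [folklore] -/
theorem killedExitTime_mono_set {S S' : Set (Site 2)} (hS' : S'.Finite) (hSS' : S ⊆ S') (v : Site 2) :
    killedExitTime Gr S v ≤ killedExitTime Gr S' v := by
  have hS : S.Finite := hS'.subset hSS'
  rw [killedExitTime_eq hS, killedExitTime_eq hS']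
  calc ∑ y ∈ hS.toFinset, killedRegionGreen Gr S v y
      ≤ ∑ y ∈ hS.toFinset, killedRegionGreen Gr S' v y :=
        Finset.sum_le_sum fun y _ => killedRegionGreen_mono_set hS' hSS' v y
    _ ≤ ∑ y ∈ hS'.toFinset, killedRegionGreen Gr S' v y :=
        Finset.sum_le_sum_of_subset_of_nonneg (Set.Finite.toFinset_subset_toFinset.2 hSS')
          fun y _ _ => killedRegionGreen_nonneg S' v y

/-- Monotonicity of the exit time in the graph. [folklore] -/
theorem killedExitTime_mono_graph {Gr Gr' : SimpleGraph (Site 2)} (hle : Gr ≤ Gr') (S : Set (Site 2)) (v : Site 2) :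
    killedExitTime Gr S v ≤ killedExitTime Gr' S v := by
  by_cases hS : S.Finite
  · rw [killedExitTime_eq hS, killedExitTime_eq hS]
    exact Finset.sum_le_sum fun y _ => killedRegionGreen_mono_graph hle S v y
  · simp [killedExitTime, hS]

/-- The squared Euclidean distance from `c` on `ℤ²`, as a real function. [folklore] -/
def normSqFrom (c : Site 2) (v : Site 2) : ℝ := ((v 0 - c 0 : ℤ) : ℝ) ^ 2 + ((v 1 - c 1 : ℤ) : ℝ) ^ 2

/-- `normSqFrom` is nonnegative. [folklore] -/
theorem normSqFrom_nonneg (c v : Site 2) : 0 ≤ normSqFrom c v := by unfold normSqFrom; positivity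

/-- **The free average of the squared distance is the squared distance plus one**
(`Δ |x|² = 4` on `ℤ²`): for the full lattice `zdGraph 2`,
`killedAvg (zdGraph 2) (normSqFrom c) v = normSqFrom c v + 1`. [folklore] -/
theorem killedAvg_normSqFrom (c v : Site 2) :
    killedAvg (zdGraph 2) (normSqFrom c) v = normSqFrom c v + 1 := by
  rw [killedAvg_eq_of_forall_adj (zdGraph 2) (fun e => zdGraph_adj_add_stepVec v e), Fin.sum_univ_four]
  simp only [normSqFrom, cornerUnit, Pi.add_apply, Pi.neg_apply, Pi.single_apply]
  simp
  ring

/-- For any subgraph, the killed average of the squared distance is at most the squared distance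
plus one (nonnegative terms are dropped). [folklore] -/
theorem killedAvg_normSqFrom_le {Gr : SimpleGraph (Site 2)} (hGr : Gr ≤ zdGraph 2) (c v : Site 2) :
    killedAvg Gr (normSqFrom c) v ≤ normSqFrom c v + 1 := by
  rw [← killedAvg_normSqFrom c v]
  exact killedAvg_mono_graph hGr (normSqFrom_nonneg c) v

/-- **Upper bound for the exit time of the free walk** (`E[τ] ≤ R²`-type bound): for the full
lattice, if `normSqFrom c ≤ M` (`0 ≤ M`) on the outer boundary of the finite region `S`, then
`T_S v + normSqFrom c v ≤ M` on `S` (`T + |· - c|²` is harmonic for the free walk).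
[cite: Chelkak2016, §2.4 (T)] -/
theorem killedExitTime_add_normSqFrom_le_free {S : Set (Site 2)} (hS : S.Finite) (c : Site 2) {M : ℝ}
    (hM0 : 0 ≤ M) (hM : ∀ w ∈ killedOuterBoundary (zdGraph 2) S, normSqFrom c w ≤ M) :
    ∀ v ∈ S, killedExitTime (zdGraph 2) S v + normSqFrom c v ≤ M := by
  have hharm : IsKilledHarmonicOn (zdGraph 2) (fun w => killedExitTime (zdGraph 2) S w + normSqFrom c w) S := by
    intro v hv
    have h1 := killedAvg_killedExitTime_sub (Gr := zdGraph 2) hS v hv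
    have h2 := killedAvg_normSqFrom c v
    have h3 : killedAvg (zdGraph 2) (fun w => killedExitTime (zdGraph 2) S w + normSqFrom c w) v =
        killedAvg (zdGraph 2) (killedExitTime (zdGraph 2) S) v + killedAvg (zdGraph 2) (normSqFrom c) v :=
      killedAvg_add (zdGraph 2) _ _ v
    rw [h3]; linarith
  exact hharm.le_of_forall_boundary_le hS hM0 fun w hw => by
    simp only [killedExitTime_of_not_mem hw.1, zero_add]; exact hM w hw

/-- **Upper bound for the exit time** of the killed walk on a subgraph `Gr ≤ ℤ²`: with `M` as in
`killedExitTime_add_normSqFrom_le_free`, `T_S v ≤ M - normSqFrom c v` on `S` (killing and leaving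
only shorten the time: monotonicity in the graph). In particular `T_S ≤ R²`-type bounds for a
region of diameter `R`. (Chelkak 2016, property (T), upper half.) [cite: Chelkak2016, §2.4 (T)] -/
theorem killedExitTime_le_sub_normSqFrom {Gr : SimpleGraph (Site 2)} (hGr : Gr ≤ zdGraph 2) {S : Set (Site 2)}
    (hS : S.Finite) (c : Site 2) {M : ℝ} (hM0 : 0 ≤ M)
    (hM : ∀ w ∈ killedOuterBoundary (zdGraph 2) S, normSqFrom c w ≤ M) :
    ∀ v ∈ S, killedExitTime Gr S v ≤ M - normSqFrom c v := fun v hv => by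
  have h1 := killedExitTime_mono_graph hGr S v
  have h2 := killedExitTime_add_normSqFrom_le_free hS c hM0 hM v hv
  linarith

/-- Where all four lattice edges are `Gr`-edges at the sites of `B`, the killed average on `B` is
the free average. [folklore] -/
theorem killedAvg_eq_killedAvg_zdGraph {Gr : SimpleGraph (Site 2)} {B : Set (Site 2)}
    (hfree : ∀ v ∈ B, ∀ e : SRW.Dir 2, Gr.Adj v (v + SRW.stepVec e)) (f : Site 2 → ℝ) :
    ∀ v ∈ B, killedAvg Gr f v = killedAvg (zdGraph 2) f v := fun v hv => by
  rw [killedAvg_eq_of_forall_adj Gr (hfree v hv),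
    killedAvg_eq_of_forall_adj (zdGraph 2) (fun e => zdGraph_adj_add_stepVec v e)]

/-- **Lower bound for the exit time** (`E[τ] ≳ r²`): if all four lattice edges are `Gr`-edges at
every site of a finite set `B ⊆ S` and `r² ≤ normSqFrom u` off `B` (i.e. `B ⊇` the lattice
points of the open disc of radius `r` about `u`... as far as they matter), then
`r² - normSqFrom u v ≤ T_S v` for `v ∈ B`. (Chelkak 2016, property (T), lower half, for the
square lattice.) [cite: Chelkak2016, §2.4 (T)] -/
theorem sub_normSqFrom_le_killedExitTime {Gr : SimpleGraph (Site 2)} {S B : Set (Site 2)} (hS : S.Finite)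
    (hBS : B ⊆ S) (hfree : ∀ v ∈ B, ∀ e : SRW.Dir 2, Gr.Adj v (v + SRW.stepVec e)) (u : Site 2) {r : ℝ}
    (hr : ∀ w ∉ B, r ^ 2 ≤ normSqFrom u w) :
    ∀ v ∈ B, r ^ 2 - normSqFrom u v ≤ killedExitTime Gr S v := by
  have hB : B.Finite := hS.subset hBS
  -- `h = T_B + q - r²` is `Gr`-harmonic on `B` with nonnegative boundary values
  have hharm : IsKilledHarmonicOn Gr (fun w => killedExitTime Gr B w + normSqFrom u w - r ^ 2) B := by
    intro v hv
    have h1 := killedAvg_killedExitTime_sub (Gr := Gr) hB v hv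
    have h2 : killedAvg Gr (normSqFrom u) v = normSqFrom u v + 1 := by
      rw [killedAvg_eq_killedAvg_zdGraph hfree _ v hv, killedAvg_normSqFrom]
    have hsplit : (fun w => killedExitTime Gr B w + normSqFrom u w - r ^ 2) =
        (fun w => killedExitTime Gr B w + normSqFrom u w) + fun _ => -r ^ 2 := by
      funext w; simp only [Pi.add_apply]; ring
    have h4 : killedAvg Gr (fun _ => -r ^ 2) v = -r ^ 2 := by
      rw [killedAvg_eq_of_forall_adj Gr (hfree v hv), Fin.sum_univ_four]; ring
    rw [hsplit, killedAvg_add]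
    have h5 : killedAvg Gr (fun w => killedExitTime Gr B w + normSqFrom u w) v =
        killedAvg Gr (killedExitTime Gr B) v + killedAvg Gr (normSqFrom u) v := killedAvg_add Gr _ _ v
    rw [h5, h4, h2, Pi.add_apply]
    linarith
  intro v hv
  have key := hharm.ge_of_forall_boundary_ge hB le_rfl (fun w hw => by
    simp only [killedExitTime_of_not_mem hw.1, zero_add, sub_nonneg]; exact hr w hw.1) v hv
  have hmono := killedExitTime_mono_set (Gr := Gr) hS hBS v
  linarith

end Literature.Probability.LatticeModels
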